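import Summits.Parity.GeneralizedHardyLittlewood.Theorems.LiouvilleShiftedTablesEngineToPairsSieveHB
import Summits.Parity.GeneralizedHardyLittlewood.Theorems.LiouvilleShiftedTablesEngineToPairsDefs

/-!
# Correlation sieve for line `Sketch` of the crux `EngineToPairs` (stmt-Parity-14659), part 4:
# the Heath-Brown factors, their splits and boxes — pointwise facts

Support file for the stub `stub_sieve : CorrelationSieveFamily`, continuing part 1 (`…SieveHB`).
For `j ∈ {1,2,3}` the `j`-th Heath-Brown piece is the Dirichlet product over `ι = Fin (2j)` of the factors
`hbF U j i` (truncated Möbius for `i < j`, `ζ` for `j ≤ i < 2j−1`, `log` for `i = 2j−1`); the smooth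
factors (`j ≤ i`) are split at a threshold `V` according to a set `L` of indices (`selF`), and every factor
is then restricted to a dyadic box (`BFI.boxRestrict x 1 k`).  This file collects the pointwise facts the
dispatch needs: `hbPiece = ∏ hbF`, bounds `|·| ≤ 1` / `≤ log`, supports (box, threshold, `≤ U`), the interval
shape of a boxed smooth factor, divisor bounds for products (`abs_prod_apply_le_of_abs_le`), support bounds
(`prod_apply_ne_zero_lower/box`, `exists_ne_zero_of_prod_apply_ne_zero`), unit factors (`prod_mul_apply_of_support_one`).
-/

noncomputable section

namespace Summit.Parity.GeneralizedHardyLittlewood.Theorems.EngineToPairs.Sieve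

open Finset Real
open scoped ArithmeticFunction.zeta ArithmeticFunction.Moebius ArithmeticFunction.sigma
open Literature.NumberTheory.Sieve Literature.NumberTheory.Sieve.BFI

/-! ### The factors -/

/-- The `i`-th factor of the `j`-th Heath-Brown piece, indexed by `Fin (2j)`. [this line] -/
def hbF (U j : ℕ) (i : Fin (2 * j)) : ArithmeticFunction ℝ := hbFactor U j i.val

/-- The smooth indices `j ≤ i` (the `ζ` and `log` factors). [this line] -/
def smoothIdx (j : ℕ) : Finset (Fin (2 * j)) := univ.filter (fun i : Fin (2 * j) => j ≤ i.val)

/-- Membership in `smoothIdx`. [folklore] -/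
theorem mem_smoothIdx {j : ℕ} {i : Fin (2 * j)} : i ∈ smoothIdx j ↔ j ≤ i.val := by
  simp [smoothIdx]

/-- The factor selected by `L`: Möbius factors whole, smooth factors split at `V` (high part on `L`). [this line] -/
def selF (V : ℝ) (U j : ℕ) (L : Finset (Fin (2 * j))) (i : Fin (2 * j)) : ArithmeticFunction ℝ :=
  if i ∈ smoothIdx j then splitSel V L (hbF U j) i else hbF U j i

/-- `hbPiece U j = ∏_i hbF U j i` (`j ≥ 1`). [cite: BombieriFriedlanderIwaniecActa1986, §2 (2.1) p. 211] -/
theorem hbPiece_eq_prod_hbF (U : ℕ) {j : ℕ} (hj : 1 ≤ j) : hbPiece U j = ∏ i : Fin (2 * j), hbF U j i := by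
  rw [hbPiece_eq_prod_hbFactor U hj, Finset.prod_range]
  rfl

/-- The binomial expansion of the Heath-Brown piece over the subsets `L` of smooth indices. [this line] -/
theorem prod_hbF_eq_sum_powerset (V : ℝ) (U j : ℕ) :
    (∏ i : Fin (2 * j), hbF U j i) = ∑ L ∈ (smoothIdx j).powerset, ∏ i : Fin (2 * j), selF V U j L i := by
  rw [prod_eq_sum_powerset_prod_splitSel V (smoothIdx j) (hbF U j)]
  rfl
/-! ### Pointwise bounds -/

/-- `|μ_{≤U}(n)| ≤ 1`, `|ζ(n)| ≤ 1`: the non-`log` factors are `1`-bounded. [folklore] -/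
theorem abs_hbF_le_one {U j : ℕ} {i : Fin (2 * j)} (hi : i.val ≠ 2 * j - 1) (n : ℕ) : |hbF U j i n| ≤ 1 := by
  unfold hbF hbFactor
  split_ifs with h1 h2
  · rw [ArithmeticFunction.intCoe_apply, moebiusTrunc_apply]
    split_ifs
    · exact_mod_cast ArithmeticFunction.abs_moebius_le_one
    · simp
  · rw [ArithmeticFunction.natCoe_apply, ArithmeticFunction.zeta_apply]
    split_ifs <;> simp
  · omega

/-- The `log` factor: `hbF U j i n = log n` for `i = 2j − 1`, `j ≥ 1`. [folklore] -/
theorem hbF_log_apply {U j : ℕ} (hj : 1 ≤ j) {i : Fin (2 * j)} (hi : i.val = 2 * j - 1) (n : ℕ) :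
    hbF U j i n = Real.log n := by
  unfold hbF hbFactor
  rw [if_neg (by omega), if_neg (by omega), ArithmeticFunction.log_apply]

/-- The `ζ` factors: `hbF U j i n = 1` for `j ≤ i < 2j − 1` and `n ≠ 0`. [folklore] -/
theorem hbF_zeta_apply {U j : ℕ} {i : Fin (2 * j)} (hi1 : j ≤ i.val) (hi2 : i.val ≠ 2 * j - 1) {n : ℕ}
    (hn : n ≠ 0) : hbF U j i n = 1 := by
  unfold hbF hbFactor
  have : i.val < 2 * j := i.isLt
  rw [if_neg (by omega), if_pos (by omega), ArithmeticFunction.natCoe_apply, ArithmeticFunction.zeta_apply,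
    if_neg hn, Nat.cast_one]

/-- The Möbius factors vanish above `U`. [folklore] -/
theorem hbF_moebius_eq_zero {U j : ℕ} {i : Fin (2 * j)} (hi : i.val < j) {n : ℕ} (hn : U < n) :
    hbF U j i n = 0 := by
  unfold hbF hbFactor
  rw [if_pos hi, ArithmeticFunction.intCoe_apply, moebiusTrunc_apply, if_neg (not_le.2 hn), Int.cast_zero]

/-- `|selF V U j L i n| ≤ |hbF U j i n|`. [folklore] -/
theorem abs_selF_le (V : ℝ) (U j : ℕ) (L : Finset (Fin (2 * j))) (i : Fin (2 * j)) (n : ℕ) :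
    |selF V U j L i n| ≤ |hbF U j i n| := by
  unfold selF splitSel
  split_ifs
  · exact abs_splitHigh_le _ _ n
  · exact abs_splitLow_le _ _ n
  · exact le_rfl

/-- The non-`log` selected factors are `1`-bounded. [folklore] -/
theorem abs_selF_le_one (V : ℝ) {U j : ℕ} (L : Finset (Fin (2 * j))) {i : Fin (2 * j)}
    (hi : i.val ≠ 2 * j - 1) (n : ℕ) : |selF V U j L i n| ≤ 1 :=
  (abs_selF_le V U j L i n).trans (abs_hbF_le_one hi n)

/-- The `log` selected factor is bounded by `log n` (`n ≥ 1`; and by `0 ≤ ·`). [folklore] -/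
theorem abs_selF_log_le (V : ℝ) {U j : ℕ} (hj : 1 ≤ j) (L : Finset (Fin (2 * j))) {i : Fin (2 * j)}
    (hi : i.val = 2 * j - 1) (n : ℕ) : |selF V U j L i n| ≤ Real.log n := by
  refine (abs_selF_le V U j L i n).trans ?_
  rw [hbF_log_apply hj hi, abs_of_nonneg (Real.log_natCast_nonneg n)]

/-- `|boxRestrict x 1 k F n| ≤ |F n|` (re-export of the tree lemma in our setting). [folklore] -/
theorem abs_box_le (x : ℝ) (k : ℕ) (F : ArithmeticFunction ℝ) (n : ℕ) : |boxRestrict x 1 k F n| ≤ |F n| :=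
  abs_boxRestrict_le k F n
/-! ### Supports -/

/-- Support of a boxed factor: the box. [folklore] -/
theorem inBox_of_box_ne_zero {x : ℝ} {k : ℕ} {F : ArithmeticFunction ℝ} {n : ℕ} (h : boxRestrict x 1 k F n ≠ 0) :
    boxLow x 1 k < n ∧ (n : ℝ) ≤ boxHigh x 1 k ∧ F n ≠ 0 := by
  obtain ⟨hin, hF⟩ := boxRestrict_ne_zero h
  exact ⟨hin.2.1, hin.2.2, hF⟩

/-- `boxHigh = 2 · boxLow` for dyadic boxes. [folklore] -/
theorem boxHigh_eq_two_mul_boxLow (x : ℝ) (k : ℕ) : boxHigh x 1 k = 2 * boxLow x 1 k := by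
  rw [boxHigh_eq_mul_boxLow (by norm_num : (-1 : ℝ) < 1)]; norm_num

/-- `boxHigh x 1 k ≤ x` for `x ≥ 0`. [folklore] -/
theorem boxHigh_le {x : ℝ} (hx : 0 ≤ x) (k : ℕ) : boxHigh x 1 k ≤ x := by
  unfold boxHigh
  exact div_le_self hx (one_le_pow₀ (by norm_num))

/-- Support of a selected factor on `L` (high part): `n > V`. [folklore] -/
theorem lt_of_selF_ne_zero_of_mem {V : ℝ} {U j : ℕ} {L : Finset (Fin (2 * j))} {i : Fin (2 * j)}
    (hiP : i ∈ smoothIdx j) (hiL : i ∈ L) {n : ℕ} (h : selF V U j L i n ≠ 0) : V < n := by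
  unfold selF splitSel at h
  rw [if_pos hiP, if_pos hiL] at h
  exact lt_of_splitHigh_ne_zero h

/-- Support of a selected smooth factor off `L` (low part): `n ≤ V`. [folklore] -/
theorem le_of_selF_ne_zero_of_not_mem {V : ℝ} {U j : ℕ} {L : Finset (Fin (2 * j))} {i : Fin (2 * j)}
    (hiP : i ∈ smoothIdx j) (hiL : i ∉ L) {n : ℕ} (h : selF V U j L i n ≠ 0) : (n : ℝ) ≤ V := by
  unfold selF splitSel at h
  rw [if_pos hiP, if_neg hiL] at h
  exact le_of_splitLow_ne_zero h

/-- Support of a selected Möbius factor: `n ≤ U`. [folklore] -/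
theorem le_of_selF_ne_zero_moebius {V : ℝ} {U j : ℕ} {L : Finset (Fin (2 * j))} {i : Fin (2 * j)}
    (hi : i.val < j) {n : ℕ} (h : selF V U j L i n ≠ 0) : n ≤ U := by
  unfold selF at h
  rw [if_neg (by rw [mem_smoothIdx]; omega)] at h
  by_contra hU
  exact h (hbF_moebius_eq_zero hi (not_le.1 hU))

/-! ### Interval shape of the smooth selected factors -/

/-- For `V ≥ 0` and naturals: `V < n ↔ ⌊V⌋₊ < n`. [folklore] -/
theorem lt_natCast_iff_floor_lt {V : ℝ} (hV : 0 ≤ V) {n : ℕ} : V < n ↔ ⌊V⌋₊ < n := (Nat.floor_lt hV).symm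

/-- A selected `ζ` factor on `L`, boxed: the indicator of the integer interval
`[max(⌊lo⌋,⌊V⌋)+1, ⌊hi⌋]`. [this line] -/
theorem box_selF_zeta_high_apply {x V : ℝ} (hx : 0 < x) (hV : 0 ≤ V) {U j : ℕ} {L : Finset (Fin (2 * j))}
    {i : Fin (2 * j)} (hi1 : j ≤ i.val) (hi2 : i.val ≠ 2 * j - 1) (hiL : i ∈ L) (k n : ℕ) :
    boxRestrict x 1 k (selF V U j L i) n =
      if max ⌊boxLow x 1 k⌋₊ ⌊V⌋₊ + 1 ≤ n ∧ n ≤ ⌊boxHigh x 1 k⌋₊ then 1 else 0 := by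
  have hiP : i ∈ smoothIdx j := mem_smoothIdx.2 hi1
  have hlo : 0 < boxLow x 1 k := boxLow_pos hx (by norm_num) k
  rw [boxRestrict_apply]
  unfold selF splitSel
  rw [if_pos hiP, if_pos hiL, splitHigh_apply]
  by_cases hin : InBox x 1 k n
  · obtain ⟨hn0, hlo', hhi'⟩ := hin
    rw [if_pos ⟨hn0, hlo', hhi'⟩, hbF_zeta_apply hi1 hi2 hn0.ne']
    have h1 : ⌊boxLow x 1 k⌋₊ < n := (Nat.floor_lt hlo.le).2 hlo'
    have h2 : n ≤ ⌊boxHigh x 1 k⌋₊ := Nat.le_floor hhi'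
    by_cases hVn : (n : ℝ) ≤ V
    · rw [if_pos hVn, if_neg]
      rintro ⟨h3, -⟩
      have : ⌊V⌋₊ < n := by omega
      rw [← lt_natCast_iff_floor_lt hV] at this
      linarith
    · have h3 : ⌊V⌋₊ < n := (lt_natCast_iff_floor_lt hV).1 (not_le.1 hVn)
      rw [if_neg hVn, if_pos]
      exact ⟨by omega, h2⟩
  · rw [if_neg hin, if_neg]
    rintro ⟨h1, h2⟩
    apply hin
    refine ⟨by omega, ?_, (Nat.le_floor_iff (hlo.le.trans ?_)).1 h2⟩
    · exact (Nat.floor_lt hlo.le).1 (by omega)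
    · rw [boxHigh_eq_two_mul_boxLow]; linarith

/-- A selected `log` factor on `L`, boxed: `log n` on the integer interval `[max(⌊lo⌋,⌊V⌋)+1, ⌊hi⌋]`. [this line] -/
theorem box_selF_log_high_apply {x V : ℝ} (hx : 0 < x) (hV : 0 ≤ V) {U j : ℕ} (hj : 1 ≤ j)
    {L : Finset (Fin (2 * j))} {i : Fin (2 * j)} (hi : i.val = 2 * j - 1) (hiL : i ∈ L) (k n : ℕ) :
    boxRestrict x 1 k (selF V U j L i) n =
      if max ⌊boxLow x 1 k⌋₊ ⌊V⌋₊ + 1 ≤ n ∧ n ≤ ⌊boxHigh x 1 k⌋₊ then Real.log n else 0 := by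
  have hiP : i ∈ smoothIdx j := mem_smoothIdx.2 (by omega)
  have hlo : 0 < boxLow x 1 k := boxLow_pos hx (by norm_num) k
  rw [boxRestrict_apply]
  unfold selF splitSel
  rw [if_pos hiP, if_pos hiL, splitHigh_apply]
  by_cases hin : InBox x 1 k n
  · obtain ⟨hn0, hlo', hhi'⟩ := hin
    rw [if_pos ⟨hn0, hlo', hhi'⟩, hbF_log_apply hj hi]
    have h1 : ⌊boxLow x 1 k⌋₊ < n := (Nat.floor_lt hlo.le).2 hlo'
    have h2 : n ≤ ⌊boxHigh x 1 k⌋₊ := Nat.le_floor hhi'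
    by_cases hVn : (n : ℝ) ≤ V
    · rw [if_pos hVn, if_neg]
      rintro ⟨h3, -⟩
      have : ⌊V⌋₊ < n := by omega
      rw [← lt_natCast_iff_floor_lt hV] at this
      linarith
    · have h3 : ⌊V⌋₊ < n := (lt_natCast_iff_floor_lt hV).1 (not_le.1 hVn)
      rw [if_neg hVn, if_pos]
      exact ⟨by omega, h2⟩
  · rw [if_neg hin, if_neg]
    rintro ⟨h1, h2⟩
    apply hin
    refine ⟨by omega, ?_, (Nat.le_floor_iff (hlo.le.trans ?_)).1 h2⟩
    · exact (Nat.floor_lt hlo.le).1 (by omega)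
    · rw [boxHigh_eq_two_mul_boxLow]; linarith

/-- A selected smooth factor OFF `L` (low part), boxed: the (`1` or `log`) weight on the integer interval
`[⌊lo⌋+1, min(⌊hi⌋,⌊V⌋)]`. [this line] -/
theorem box_selF_low_apply {x V : ℝ} (hx : 0 < x) (hV : 0 ≤ V) {U j : ℕ} {L : Finset (Fin (2 * j))}
    {i : Fin (2 * j)} (hi1 : j ≤ i.val) (hiL : i ∉ L) (k n : ℕ) :
    boxRestrict x 1 k (selF V U j L i) n =
      if ⌊boxLow x 1 k⌋₊ + 1 ≤ n ∧ n ≤ min ⌊boxHigh x 1 k⌋₊ ⌊V⌋₊ then hbF U j i n else 0 := by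
  have hiP : i ∈ smoothIdx j := mem_smoothIdx.2 hi1
  have hlo : 0 < boxLow x 1 k := boxLow_pos hx (by norm_num) k
  rw [boxRestrict_apply]
  unfold selF splitSel
  rw [if_pos hiP, if_neg hiL, splitLow_apply]
  by_cases hin : InBox x 1 k n
  · obtain ⟨hn0, hlo', hhi'⟩ := hin
    rw [if_pos ⟨hn0, hlo', hhi'⟩]
    have h1 : ⌊boxLow x 1 k⌋₊ < n := (Nat.floor_lt hlo.le).2 hlo'
    have h2 : n ≤ ⌊boxHigh x 1 k⌋₊ := Nat.le_floor hhi'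
    by_cases hVn : (n : ℝ) ≤ V
    · have h3 : n ≤ ⌊V⌋₊ := Nat.le_floor hVn
      rw [if_pos hVn, if_pos ⟨by omega, le_min h2 h3⟩]
    · rw [if_neg hVn, if_neg]
      rintro ⟨-, h4⟩
      have : n ≤ ⌊V⌋₊ := (le_min_iff.1 h4).2
      exact hVn ((Nat.le_floor_iff hV).1 this)
  · rw [if_neg hin, if_neg]
    rintro ⟨h1, h2⟩
    apply hin
    refine ⟨by omega, ?_, (Nat.le_floor_iff (hlo.le.trans ?_)).1 (le_min_iff.1 h2).1⟩
    · exact (Nat.floor_lt hlo.le).1 (by omega)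
    · rw [boxHigh_eq_two_mul_boxLow]; linarith

/-! ### Dirichlet products of bounded factors are divisor-bounded -/

/-- If `|f_i| ≤ A_i` pointwise with `A_i ≥ 1`, then `|(∏_{i∈s} f_i)(n)| ≤ (∏_{i∈s} A_i) τ(n)^{#s}`. [folklore] -/
theorem abs_prod_apply_le_of_abs_le {ι : Type*} [DecidableEq ι] (s : Finset ι) (f : ι → ArithmeticFunction ℝ)
    (A : ι → ℝ) (hA : ∀ i ∈ s, 1 ≤ A i) (hf : ∀ i ∈ s, ∀ n, |f i n| ≤ A i) (n : ℕ) :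
    |(∏ i ∈ s, f i) n| ≤ (∏ i ∈ s, A i) * ((σ 0 n : ℕ) : ℝ) ^ s.card := by
  induction s using Finset.induction_on generalizing n with
  | empty =>
    simp only [Finset.prod_empty, Finset.card_empty, pow_zero, mul_one, ArithmeticFunction.one_apply]
    split_ifs <;> simp
  | @insert i s hi ih =>
    rw [Finset.prod_insert hi, Finset.prod_insert hi, Finset.card_insert_of_notMem hi]
    have hAi : 1 ≤ A i := hA i (Finset.mem_insert_self i s)
    have hAs : ∀ k ∈ s, 1 ≤ A k := fun k hk => hA k (Finset.mem_insert_of_mem hk)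
    have hprod : 0 ≤ ∏ k ∈ s, A k := Finset.prod_nonneg fun k hk => zero_le_one.trans (hAs k hk)
    have h := abs_mul_apply_le_sigma_zero_pow (F := f i) (G := ∏ k ∈ s, f k) (A := A i) (B := ∏ k ∈ s, A k)
      (a := 0) (b := s.card) (zero_le_one.trans hAi) hprod
      (fun d => by rw [pow_zero, mul_one]; exact hf i (Finset.mem_insert_self i s) d)
      (fun e => ih hAs (fun k hk => hf k (Finset.mem_insert_of_mem hk)) e) n
    calc |(f i * ∏ k ∈ s, f k) n| ≤ A i * (∏ k ∈ s, A k) * ((σ 0 n : ℕ) : ℝ) ^ (0 + s.card + 1) := h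
      _ = A i * (∏ k ∈ s, A k) * ((σ 0 n : ℕ) : ℝ) ^ (s.card + 1) := by rw [zero_add]

/-- `σ₀(n) = #divisors n`, so `σ₀(n)^B = tauPow B n`. [folklore] -/
theorem sigma_zero_pow_eq_tauPow (B n : ℕ) : ((σ 0 n : ℕ) : ℝ) ^ B = tauPow B n := by
  rw [tauPow, ArithmeticFunction.sigma_zero_apply]

/-- Monotonicity of `tauPow` in the exponent (`τ(n) ≥ 1` for `n ≥ 1`; at `n = 0` both vanish for `B ≥ 1`).
[folklore] -/
theorem tauPow_le_tauPow {B B' : ℕ} (h : B ≤ B') (h1 : 1 ≤ B) (n : ℕ) : tauPow B n ≤ tauPow B' n := by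
  unfold tauPow
  rcases Nat.eq_zero_or_pos n with rfl | hn
  · simp [zero_pow (by omega : B ≠ 0), zero_pow (by omega : B' ≠ 0)]
  · apply pow_le_pow_right₀ _ h
    have : 1 ≤ (Nat.divisors n).card := Finset.card_pos.2 ⟨1, Nat.one_mem_divisors.2 hn.ne'⟩
    exact_mod_cast this

/-! ### Supports of products -/

/-- **Lower bound for the support of a product**: if every factor `f_i` (`i ∈ s`) lives on `d ≥ a_i` with
`a_i ≥ 0`, then `∏_{i∈s} f_i` lives on `n ≥ ∏ a_i`. [folklore] -/
theorem prod_apply_ne_zero_lower {ι : Type*} [DecidableEq ι] (s : Finset ι) {f : ι → ArithmeticFunction ℝ}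
    {a : ι → ℝ} (ha : ∀ i ∈ s, 0 ≤ a i) (hf : ∀ i ∈ s, ∀ d : ℕ, f i d ≠ 0 → a i ≤ d) {n : ℕ}
    (hn : (∏ i ∈ s, f i) n ≠ 0) : (∏ i ∈ s, a i) ≤ n := by
  induction s using Finset.induction_on generalizing n with
  | empty =>
    simp only [Finset.prod_empty, ArithmeticFunction.one_apply, ne_eq, ite_eq_right_iff, one_ne_zero,
      imp_false, not_not] at hn
    subst hn; simp
  | @insert i s hi ih =>
    rw [Finset.prod_insert hi, ArithmeticFunction.mul_apply] at hn
    obtain ⟨p, hp, hp0⟩ := Finset.exists_ne_zero_of_sum_ne_zero hn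
    obtain ⟨hpn, -⟩ := Nat.mem_divisorsAntidiagonal.1 hp
    have h1 : a i ≤ p.1 := hf i (Finset.mem_insert_self i s) p.1 (left_ne_zero_of_mul hp0)
    have h2 : (∏ k ∈ s, a k) ≤ p.2 := ih (fun k hk => ha k (Finset.mem_insert_of_mem hk))
      (fun k hk d hd => hf k (Finset.mem_insert_of_mem hk) d hd) (right_ne_zero_of_mul hp0)
    rw [Finset.prod_insert hi, ← hpn, Nat.cast_mul]
    exact mul_le_mul h1 h2 (Finset.prod_nonneg fun k hk => ha k (Finset.mem_insert_of_mem hk)) (Nat.cast_nonneg _)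

/-- Every factor of a non-vanishing product is non-zero at some divisor. [folklore] -/
theorem exists_ne_zero_of_prod_apply_ne_zero {ι : Type*} [DecidableEq ι] (s : Finset ι)
    {f : ι → ArithmeticFunction ℝ} {n : ℕ} (hn : (∏ i ∈ s, f i) n ≠ 0) :
    ∀ i ∈ s, ∃ d : ℕ, d ∣ n ∧ f i d ≠ 0 := by
  induction s using Finset.induction_on generalizing n with
  | empty => intro i hi; exact absurd hi (Finset.notMem_empty i)
  | @insert i s hi ih =>
    rw [Finset.prod_insert hi, ArithmeticFunction.mul_apply] at hn
    obtain ⟨p, hp, hp0⟩ := Finset.exists_ne_zero_of_sum_ne_zero hn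
    obtain ⟨hpn, -⟩ := Nat.mem_divisorsAntidiagonal.1 hp
    intro k hk
    rcases Finset.mem_insert.1 hk with rfl | hk'
    · exact ⟨p.1, ⟨p.2, hpn.symm⟩, left_ne_zero_of_mul hp0⟩
    · obtain ⟨d, hd, hd0⟩ := ih (right_ne_zero_of_mul hp0) k hk'
      exact ⟨d, hd.trans ⟨p.1, by rw [mul_comm]; exact hpn.symm⟩, hd0⟩

/-- **Support of a product in boxes** (re-export of the tree lemma for dyadic boxes): if every factor
lives in `(lo_i, 2 lo_i]` with `lo_i ≥ 0` then the product lives in `(∏ lo_i, 2^{#s} ∏ lo_i]`. [folklore] -/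
theorem prod_apply_ne_zero_box {ι : Type*} [DecidableEq ι] {s : Finset ι} (hs : s.Nonempty)
    {f : ι → ArithmeticFunction ℝ} {lo : ι → ℝ} (hlo : ∀ i ∈ s, 0 ≤ lo i)
    (hf : ∀ i ∈ s, ∀ d : ℕ, f i d ≠ 0 → lo i < d ∧ (d : ℝ) ≤ 2 * lo i) {n : ℕ}
    (hn : (∏ i ∈ s, f i) n ≠ 0) : (∏ i ∈ s, lo i) < n ∧ (n : ℝ) ≤ 2 ^ s.card * ∏ i ∈ s, lo i := by
  obtain ⟨h1, h2⟩ := prod_apply_ne_zero_bounds hs hlo hf hn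
  refine ⟨h1, h2.trans (le_of_eq ?_)⟩
  rw [Finset.prod_mul_distrib, Finset.prod_const]

/-! ### Factors living on `{1}` act as scalars -/

/-- If `f` vanishes off `{1}` then `(f ⋆ g)(n) = f(1) g(n)`. [folklore] -/
theorem mul_apply_of_support_one (f g : ArithmeticFunction ℝ) (h : ∀ n, n ≠ 1 → f n = 0) (n : ℕ) :
    (f * g) n = f 1 * g n := by
  rcases Nat.eq_zero_or_pos n with rfl | hn
  · simp
  rw [ArithmeticFunction.mul_apply]
  rw [Finset.sum_eq_single (1, n)]
  · intro p hp hpne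
    obtain ⟨hpn, -⟩ := Nat.mem_divisorsAntidiagonal.1 hp
    by_cases hp1 : p.1 = 1
    · exfalso
      apply hpne
      have hp2 : p.2 = n := by rw [← hpn, hp1, one_mul]
      exact Prod.ext hp1 hp2
    · rw [h p.1 hp1, zero_mul]
  · intro hmem
    exfalso
    exact hmem (Nat.mem_divisorsAntidiagonal.2 ⟨one_mul n, hn.ne'⟩)

/-- Unit factors pulled out of a product: if every `f_i` (`i ∈ Un`) vanishes off `{1}` then
`((∏_{i∈Un} f_i) ⋆ G)(n) = (∏_{i∈Un} f_i(1)) · G(n)`. [folklore] -/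
theorem prod_mul_apply_of_support_one {ι : Type*} [DecidableEq ι] (Un : Finset ι) (f : ι → ArithmeticFunction ℝ)
    (h : ∀ i ∈ Un, ∀ n, n ≠ 1 → f i n = 0) (G : ArithmeticFunction ℝ) (n : ℕ) :
    ((∏ i ∈ Un, f i) * G) n = (∏ i ∈ Un, f i 1) * G n := by
  induction Un using Finset.induction_on generalizing G with
  | empty => simp
  | @insert i s hi ih =>
    rw [Finset.prod_insert hi, Finset.prod_insert hi, mul_assoc,
      mul_apply_of_support_one (f i) _ (h i (Finset.mem_insert_self i s)) n,
      ih (fun k hk => h k (Finset.mem_insert_of_mem hk)) G, mul_assoc]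

/-- A boxed factor whose box lies below `1` (`lo < 1`) vanishes off `{1}`. [folklore] -/
theorem box_eq_zero_of_boxLow_lt_one {x : ℝ} {k : ℕ} (hk : boxLow x 1 k < 1) (F : ArithmeticFunction ℝ)
    {n : ℕ} (hn : n ≠ 1) : boxRestrict x 1 k F n = 0 := by
  rw [boxRestrict_apply]
  split_ifs with hin
  · exfalso
    obtain ⟨hn0, -, hhi⟩ := hin
    rw [boxHigh_eq_two_mul_boxLow] at hhi
    have h2 : (n : ℝ) < 2 := by linarith
    have : n < 2 := by exact_mod_cast h2
    omega
  · rfl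

/-- The value at `1` of a boxed selected factor is at most `1` in absolute value (even the `log` factor:
`log 1 = 0`). [folklore] -/
theorem abs_box_selF_one_le (x V : ℝ) (U j : ℕ) (L : Finset (Fin (2 * j))) (i : Fin (2 * j)) (k : ℕ) :
    |boxRestrict x 1 k (selF V U j L i) 1| ≤ 1 := by
  refine (abs_box_le x k _ 1).trans ((abs_selF_le V U j L i 1).trans ?_)
  by_cases hi : i.val = 2 * j - 1
  · unfold hbF hbFactor
    split_ifs <;> first
      | (rw [ArithmeticFunction.intCoe_apply, moebiusTrunc_apply]; split_ifs <;> simp)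
      | simp [ArithmeticFunction.log_apply]
  · exact abs_hbF_le_one hi 1

end Summit.Parity.GeneralizedHardyLittlewood.Theorems.EngineToPairs.Sieve

namespace Summit.Parity.GeneralizedHardyLittlewood.Theorems.EngineToPairs

/-- Registered sub-goal of `stub_sieve` carried by this part (landing mechanics): `σ₀(n)^B = tauPow B n`
(the bridge between the tree's divisor bounds and the line's `tauPow`). [folklore] -/
theorem sieve_part4_anchor : ∀ (B n : ℕ), ((ArithmeticFunction.sigma 0 n : ℕ) : ℝ) ^ B = tauPow B n :=
  Sieve.sigma_zero_pow_eq_tauPow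

end Summit.Parity.GeneralizedHardyLittlewood.Theorems.EngineToPairs

end
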